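import Summits.Ventures.HSemireg.Mod4CarrierTopForm

/-!
# Venture HSemireg — MOD-4 line: the square of the Weil part ON THE p4 CARRIER
# (`w₊∧w₊ = w₋∧w₋ = 0`, `w₋∧w₊ = (−1)^{N−p}·Θ^N/N!`, `w∧w = 2·(−1)ⁿab·Θ^{2n}/(2n)!` — so the eigen-parameter `(−1)ⁿab` is `½[w∧w : Θ^{2n}/(2n)!]`)

HONEST FRAMING. Part of the Lean index of the computation cell `pub-hsemireg` (widening group W3, seat w3-mod4-1 gen 6; file of
record `HOME/widen/W3/MOD4-OFFSPLIT-w3mod4.md` §12).  Finite-dimensional exterior algebra over a field ONLY (p4's carrier: a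
`K`-space `V` with an adapted basis `bV : Fin (N + N) → V`, `ℓ_a := bV a`, `m_a := bV (N + a)`; `wUp p = ℓ_p⋯ℓ_{N-1} m_{p-1}⋯m_0`,
`wLow p = ℓ_0⋯ℓ_{p-1} m_{N-1}⋯m_p`, `LMprod N = Π_a(ℓ_a∧m_a) = Θ^N/N!`): no abelian variety, no sheaf, no Ext group, no semiregularity
map; nothing here says that HC, HC_CM or HC_AV holds; no Literature fact is declared or used.  WHAT IS PROVED (proof-only; no
definitions): (1) a generator anticommutes past the block products with the parity of their length (`ι_mul_vac`, `ι_mul_ellprod`,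
`ι_mul_ellprodFrom`, `ι_mul_vacFrom`); (2) the block products of positive length square to zero and **`wUp p * wUp p = 0`,
`wLow p * wLow p = 0`** (`p ≥ 1`); (3) the upper block product `(m_{k-1}⋯m_p)(ℓ_p⋯ℓ_{k-1})` is central and equals
`(−1)^{k−p}·Π_{p≤c<k}(ℓ_c∧m_c)` against `LMprod p`, whence **`wLow p * wUp p = (−1)^{N−p} • LMprod N`** (companion of
`Mod4CarrierTopForm.wUp_mul_wLow = (−1)^p • LMprod N`); (4) **`weil_sq`: `(a·w₊ + b·w₋)² = ab((−1)^p + (−1)^{N−p}) • LMprod N`**,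
in Weil type `(n,n)`: **`= 2·((−1)ⁿab) • LMprod (2n)`** (`weil_sq_nn`), so in characteristic `≠ 2` the scalar `t` with
`w∧w = 2t·Θ^{2n}/(2n)!` is `(−1)ⁿab` (`eq_of_weil_sq_nn`); (5) USE (sequel `Mod4CarrierTauForm.lean`): with seat g6's
`Mod4Carrier.finrank_S_weil_nn_middle'` (THEOREM R_f's middle degree on the carrier, eigen-parameter `(−1)ⁿab`) this gives the τ-FORM:
if `w∧w = (2t) • LMprod (2n)` then `dim S_n(Ecl q (2n) + w) + 2·r_n + dim ker(M_f(q) − t) = (r_n + 2)·C(2n,n)` — the eigen-parameter is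
HALF THE RATIO OF THE TOP FORMS `w∧w : Θ^{2n}/(2n)!`; in the geometric dictionary (V = H¹, L = H^{0,1}, Θ = h, ∫ the cup-product integral;
MOD4-OFFSPLIT §1 / §10.1, NOT asserted in Lean) `t = ∫w²/(2D) = (−1)ⁿ(w,w)_χ/(2D) = (−1)ⁿτ`.
All statements and proofs: w3-mod4-1 g6 (2026-08-23).  Namespace `Summit.Ventures.HSemireg.Mod4Carrier`.
References: [BourbakiAlgebre1a3] Ch. III §7 (graded commutativity); [BuchweitzFlenner2008HH] Prop. 6.4.4 (why these operators).
-/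

open Module

namespace Summit.Ventures.HSemireg.Mod4Carrier

open Summit.Ventures.HSemireg.WedgeBridge Summit.Ventures.HSemireg.WeilCarrier
open ExteriorAlgebra (ι)

variable {K : Type*} [Field K] {N : ℕ} {V : Type*} [AddCommGroup V] [Module K V] (bV : Basis (Fin (N + N)) K V)

/-! ### 1. A generator anticommutes past the block products -/

/-- `ι u ∧ (m_{k-1} ∧ ⋯ ∧ m_0) = (−1)^k (m_{k-1} ∧ ⋯ ∧ m_0) ∧ ι u`. [cite: BourbakiAlgebre1a3, Ch. III §7 no. 1] -/
lemma ι_mul_vac (u : V) : ∀ k : ℕ, ι K u * vac bV k = ((-1 : K) ^ k) • (vac bV k * ι K u)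
  | 0 => by rw [vac, mul_one, one_mul, pow_zero, one_smul]
  | k + 1 => by
    have h : ι K u * ι K (mN bV k) = -(ι K (mN bV k) * ι K u) :=
      eq_neg_of_add_eq_zero_left (ExteriorAlgebra.ι_add_mul_swap _ _)
    rw [vac, ← mul_assoc, h, neg_mul, mul_assoc, ι_mul_vac u k, mul_smul_comm, ← mul_assoc, ← neg_smul, pow_succ,
      mul_neg_one]

/-- `ι u ∧ (ℓ_0 ∧ ⋯ ∧ ℓ_{k-1}) = (−1)^k (ℓ_0 ∧ ⋯ ∧ ℓ_{k-1}) ∧ ι u`. -/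
lemma ι_mul_ellprod (u : V) : ∀ k : ℕ, ι K u * ellprod bV k = ((-1 : K) ^ k) • (ellprod bV k * ι K u)
  | 0 => by rw [ellprod, mul_one, one_mul, pow_zero, one_smul]
  | k + 1 => by
    have h : ι K u * ι K (ℓN bV k) = -(ι K (ℓN bV k) * ι K u) :=
      eq_neg_of_add_eq_zero_left (ExteriorAlgebra.ι_add_mul_swap _ _)
    rw [ellprod, ← mul_assoc, ι_mul_ellprod u k, smul_mul_assoc, mul_assoc, h, mul_neg, smul_neg, ← mul_assoc,
      ← neg_smul, pow_succ, mul_neg_one]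

/-- `ι u ∧ (ℓ_p ∧ ⋯ ∧ ℓ_{k-1}) = (−1)^{k−p} (ℓ_p ∧ ⋯ ∧ ℓ_{k-1}) ∧ ι u`. -/
lemma ι_mul_ellprodFrom (u : V) (p : ℕ) : ∀ k : ℕ,
    ι K u * ellprodFrom bV p k = ((-1 : K) ^ (k - p)) • (ellprodFrom bV p k * ι K u)
  | 0 => by rw [ellprodFrom, mul_one, one_mul, Nat.zero_sub, pow_zero, one_smul]
  | k + 1 => by
    by_cases hk : p ≤ k
    · have h : ι K u * ι K (ℓN bV k) = -(ι K (ℓN bV k) * ι K u) :=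
        eq_neg_of_add_eq_zero_left (ExteriorAlgebra.ι_add_mul_swap _ _)
      rw [ellprodFrom, if_pos hk, ← mul_assoc, ι_mul_ellprodFrom u p k, smul_mul_assoc, mul_assoc, h, mul_neg, smul_neg,
        ← mul_assoc, ← neg_smul, show k + 1 - p = (k - p) + 1 by omega, pow_succ, mul_neg_one]
    · rw [ellprodFrom, if_neg hk, mul_one, ι_mul_ellprodFrom u p k, show k + 1 - p = k - p by omega]

/-- `ι u ∧ (m_{k-1} ∧ ⋯ ∧ m_p) = (−1)^{k−p} (m_{k-1} ∧ ⋯ ∧ m_p) ∧ ι u`. -/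
lemma ι_mul_vacFrom (u : V) (p : ℕ) : ∀ k : ℕ,
    ι K u * vacFrom bV p k = ((-1 : K) ^ (k - p)) • (vacFrom bV p k * ι K u)
  | 0 => by rw [vacFrom, mul_one, one_mul, Nat.zero_sub, pow_zero, one_smul]
  | k + 1 => by
    by_cases hk : p ≤ k
    · have h : ι K u * ι K (mN bV k) = -(ι K (mN bV k) * ι K u) :=
        eq_neg_of_add_eq_zero_left (ExteriorAlgebra.ι_add_mul_swap _ _)
      rw [vacFrom, if_pos hk, ← mul_assoc, h, neg_mul, mul_assoc, ι_mul_vacFrom u p k, mul_smul_comm, ← mul_assoc,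
        ← neg_smul, show k + 1 - p = (k - p) + 1 by omega, pow_succ, mul_neg_one]
    · rw [vacFrom, if_neg hk, one_mul, ι_mul_vacFrom u p k, show k + 1 - p = k - p by omega]

/-! ### 2. Squares of the block products vanish; cross-commutations -/

/-- `(m_{k-1} ∧ ⋯ ∧ m_0)² = 0` for `k ≥ 1`. -/
lemma vac_mul_self : ∀ k : ℕ, 1 ≤ k → vac bV k * vac bV k = 0
  | 0, h => absurd h (by omega)
  | k + 1, _ => by
    have h2 : vac bV k * ι K (mN bV k) = ((-1 : K) ^ k) • (ι K (mN bV k) * vac bV k) := by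
      rw [ι_mul_vac, smul_smul, ← pow_add, ← two_mul, pow_mul, neg_one_sq, one_pow, one_smul]
    rw [vac, mul_assoc, ← mul_assoc (vac bV k), h2, smul_mul_assoc, mul_smul_comm, ← mul_assoc, ← mul_assoc,
      ExteriorAlgebra.ι_sq_zero, zero_mul, zero_mul, smul_zero]

/-- `(ℓ_0 ∧ ⋯ ∧ ℓ_{k-1})² = 0` for `k ≥ 1`. -/
lemma ellprod_mul_self : ∀ k : ℕ, 1 ≤ k → ellprod bV k * ellprod bV k = 0
  | 0, h => absurd h (by omega)
  | k + 1, _ => by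
    rw [ellprod, mul_assoc, ← mul_assoc (ι K (ℓN bV k)) (ellprod bV k), ι_mul_ellprod, smul_mul_assoc, mul_smul_comm,
      mul_assoc, ExteriorAlgebra.ι_sq_zero, mul_zero, mul_zero, smul_zero]

/-- the lower vacuum passes the upper `ℓ`-block: `vac k * ellprodFrom p M = (−1)^{k(M−p)} ellprodFrom p M * vac k`. -/
lemma vac_mul_ellprodFrom (p M : ℕ) : ∀ k : ℕ,
    vac bV k * ellprodFrom bV p M = ((-1 : K) ^ (k * (M - p))) • (ellprodFrom bV p M * vac bV k)
  | 0 => by rw [vac, one_mul, mul_one, zero_mul, pow_zero, one_smul]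
  | k + 1 => by
    rw [vac, mul_assoc, vac_mul_ellprodFrom p M k, mul_smul_comm, ← mul_assoc, ι_mul_ellprodFrom, smul_mul_assoc, smul_smul,
      mul_assoc, ← pow_add]
    congr 2
    ring

/-- the upper vacuum passes the lower `ℓ`-block: `vacFrom p M * ellprod k = (−1)^{(M−p)k} ellprod k * vacFrom p M`. -/
lemma vacFrom_mul_ellprod (p k : ℕ) : ∀ M : ℕ,
    vacFrom bV p M * ellprod bV k = ((-1 : K) ^ ((M - p) * k)) • (ellprod bV k * vacFrom bV p M)
  | 0 => by rw [vacFrom, one_mul, mul_one, Nat.zero_sub, zero_mul, pow_zero, one_smul]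
  | M + 1 => by
    by_cases h : p ≤ M
    · rw [vacFrom, if_pos h, mul_assoc, vacFrom_mul_ellprod p k M, mul_smul_comm, ← mul_assoc, ι_mul_ellprod,
        smul_mul_assoc, smul_smul, mul_assoc, ← pow_add, show M + 1 - p = (M - p) + 1 by omega]
      congr 2
      ring
    · rw [vacFrom, if_neg h, one_mul, vacFrom_mul_ellprod p k M, show M + 1 - p = M - p by omega]

/-- **`w₊ ∧ w₊ = 0`** (`p ≥ 1`). -/
theorem wUp_mul_self {p : ℕ} (hp1 : 1 ≤ p) : wUp bV p * wUp bV p = 0 := by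
  rw [wUp, mul_assoc, ← mul_assoc (vac bV p) (ellprodFrom bV p N), vac_mul_ellprodFrom, smul_mul_assoc, mul_smul_comm,
    mul_assoc, vac_mul_self bV p hp1, mul_zero, mul_zero, smul_zero]

/-- **`w₋ ∧ w₋ = 0`** (`p ≥ 1`). -/
theorem wLow_mul_self {p : ℕ} (hp1 : 1 ≤ p) : wLow bV p * wLow bV p = 0 := by
  rw [wLow, mul_assoc, ← mul_assoc (vacFrom bV p N) (ellprod bV p), vacFrom_mul_ellprod, smul_mul_assoc, mul_smul_comm,
    ← mul_assoc, ← mul_assoc, ellprod_mul_self bV p hp1, zero_mul, zero_mul, smul_zero]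

/-! ### 3. The reversed top product `w₋ ∧ w₊` -/

/-- the upper block product `Y_k = (m_{k-1}⋯m_p)(ℓ_p⋯ℓ_{k-1})` is CENTRAL and equals `(−1)^{k−p}·Π_{p≤c<k}(ℓ_c∧m_c)`:
`Y_k * x = x * Y_k` and `Y_k * LMprod p = (−1)^{k−p} • LMprod k` (`p ≤ k`). -/
lemma vacFrom_mul_ellprodFrom (p : ℕ) : ∀ k : ℕ,
    (∀ x : ExteriorAlgebra K V,
        vacFrom bV p k * ellprodFrom bV p k * x = x * (vacFrom bV p k * ellprodFrom bV p k)) ∧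
      (p ≤ k → vacFrom bV p k * ellprodFrom bV p k * LMprod bV p = ((-1 : K) ^ (k - p)) • LMprod bV k)
  | 0 => by
    refine ⟨fun x => by rw [vacFrom, ellprodFrom, one_mul, one_mul, mul_one], fun h => ?_⟩
    obtain rfl := Nat.le_zero.mp h
    rw [vacFrom, ellprodFrom, one_mul, one_mul, Nat.sub_self, pow_zero, one_smul]
  | k + 1 => by
    obtain ⟨ih1, ih2⟩ := vacFrom_mul_ellprodFrom p k
    by_cases hk : p ≤ k
    · have hY : vacFrom bV p (k + 1) * ellprodFrom bV p (k + 1) =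
          -(LM bV k * (vacFrom bV p k * ellprodFrom bV p k)) := by
        rw [vacFrom, ellprodFrom, if_pos hk, if_pos hk]
        calc ι K (mN bV k) * vacFrom bV p k * (ellprodFrom bV p k * ι K (ℓN bV k))
            = ι K (mN bV k) * (vacFrom bV p k * ellprodFrom bV p k * ι K (ℓN bV k)) := by simp only [mul_assoc]
          _ = ι K (mN bV k) * ι K (ℓN bV k) * (vacFrom bV p k * ellprodFrom bV p k) := by rw [ih1, ← mul_assoc]
          _ = -(LM bV k * (vacFrom bV p k * ellprodFrom bV p k)) := by rw [m_mul_ℓ, neg_mul]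
      refine ⟨fun x => ?_, fun _ => ?_⟩
      · rw [hY, neg_mul, mul_assoc, ih1 x, ← mul_assoc, LM_comm, mul_assoc, ← mul_neg]
      · rw [hY, neg_mul, mul_assoc, ih2 hk, mul_smul_comm, LMprod, ← neg_smul, show k + 1 - p = (k - p) + 1 by omega,
          pow_succ, mul_neg_one]
    · have h1 : vacFrom bV p (k + 1) * ellprodFrom bV p (k + 1) = 1 := by
        rw [vacFrom, ellprodFrom, if_neg hk, if_neg hk, one_mul, mul_one, vacFrom_of_le bV (show k ≤ p by omega),
          ellprodFrom_of_le bV (show k ≤ p by omega), mul_one]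
      refine ⟨fun x => by rw [h1, one_mul, mul_one], fun h => ?_⟩
      obtain rfl : p = k + 1 := by omega
      rw [h1, one_mul, Nat.sub_self, pow_zero, one_smul]

/-- **`w₋ ∧ w₊ = (−1)^{N−p} · Θ^N/N!` ON THE CARRIER** (`p ≤ N`). [cite: BourbakiAlgebre1a3, Ch. III §7 no. 1] -/
theorem wLow_mul_wUp {p : ℕ} (hp : p ≤ N) : wLow bV p * wUp bV p = ((-1 : K) ^ (N - p)) • LMprod bV N := by
  obtain ⟨h1, h2⟩ := vacFrom_mul_ellprodFrom bV p N
  rw [wLow, wUp]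
  calc ellprod bV p * vacFrom bV p N * (ellprodFrom bV p N * vac bV p)
      = ellprod bV p * (vacFrom bV p N * ellprodFrom bV p N) * vac bV p := by simp only [mul_assoc]
    _ = vacFrom bV p N * ellprodFrom bV p N * ellprod bV p * vac bV p := by rw [← h1 (ellprod bV p)]
    _ = vacFrom bV p N * ellprodFrom bV p N * LMprod bV p := by rw [mul_assoc, ellprod_mul_vac]
    _ = ((-1 : K) ^ (N - p)) • LMprod bV N := h2 hp

/-! ### 4. The square of `w = a·w₊ + b·w₋` -/

/-- **`w ∧ w = ab((−1)^p + (−1)^{N−p}) · Θ^N/N!`** for `w = a·w₊ + b·w₋`, `1 ≤ p ≤ N`. -/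
theorem weil_sq {p : ℕ} (hp1 : 1 ≤ p) (hp : p ≤ N) (a b : K) :
    (a • wUp bV p + b • wLow bV p) * (a • wUp bV p + b • wLow bV p) =
      (a * b * ((-1 : K) ^ p + (-1 : K) ^ (N - p))) • LMprod bV N := by
  rw [add_mul, mul_add, mul_add]
  simp only [smul_mul_assoc, mul_smul_comm, smul_smul, wUp_mul_self bV hp1, wLow_mul_self bV hp1, wUp_mul_wLow bV hp,
    wLow_mul_wUp bV hp, smul_zero, zero_add, add_zero]
  rw [← add_smul]
  congr 1
  ring

/-- **Weil type `(n,n)` (`n ≥ 1`): `w ∧ w = 2·((−1)ⁿab) · Θ^{2n}/(2n)!`** — twice the mixed term `(a·w₊)∧(b·w₋)` of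
`Mod4CarrierTopForm.smul_wUp_mul_smul_wLow_nn`. -/
theorem weil_sq_nn {n : ℕ} (bV : Basis (Fin ((n + n) + (n + n))) K V) (hn : 1 ≤ n) (a b : K) :
    (a • wUp bV n + b • wLow bV n) * (a • wUp bV n + b • wLow bV n) =
      (2 * ((-1 : K) ^ n * (a * b))) • LMprod bV (n + n) := by
  rw [weil_sq bV hn (Nat.le_add_right n n), Nat.add_sub_cancel]
  congr 1
  ring

/-- hence in characteristic `≠ 2` the scalar `t` with `w ∧ w = 2t · Θ^{2n}/(2n)!` is `(−1)ⁿ·ab`. -/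
theorem eq_of_weil_sq_nn {n : ℕ} (bV : Basis (Fin ((n + n) + (n + n))) K V) (hn : 1 ≤ n) {a b t : K} (h2 : (2 : K) ≠ 0)
    (ht : (a • wUp bV n + b • wLow bV n) * (a • wUp bV n + b • wLow bV n) = (2 * t) • LMprod bV (n + n)) :
    t = (-1 : K) ^ n * (a * b) := by
  rw [weil_sq_nn bV hn] at ht
  exact mul_left_cancel₀ h2 (smul_left_injective K (LMprod_ne_zero bV) ht).symm

end Summit.Ventures.HSemireg.Mod4Carrier
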